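import Summits.AtomisticToContinuum.FouriersLaw.Theses.CoercivePulse
import Summits.AtomisticToContinuum.FouriersLaw.Theorems.CoercivePulseLinearCeilingAbelMeanCeiling
import HarnessLib

/-!
# The bridge children give the Abel data of every guarded pair: Abel REGULARITY from (R), an Abel FLOOR from (R) + CLB
(crux `CoercivePulse.LinearSpread`, item stmt-AtomisticToContinuum-15382, line `KaramataCollapse`; `--supports` file, closes nothing)

WHAT. Two registered stubs of the reshaped skeleton `Cruxes/LinearSpread/Lines/KaramataCollapse.lean`, both consequences of the two
gen-1 children of the shared bridge `AbelThermodynamicLimit` — (R) = `CoercivePulse.UniformAbelianRegularity` (item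
stmt-AtomisticToContinuum-13416) and CLB = `CoercivePulse.ConductanceLowerBound` (item stmt-AtomisticToContinuum-11749) — for EVERY
guarded pair `(μ, D)` of `pinnedChain ω₂ lam β γ` at temperature `T` (shift- and reversal-invariant DLR state `μ`, `μ`-preserving `D`;
the bath constant `γ` of the arena is arbitrary — the infinite-volume objects do not see it, and (R), CLB are used at bath constant `1`):

* `stub_abelRegularityOfRegularity` : (R) → `CoercivePulse.AbelRegularity` (item stmt-15384, by name): the Abel means
  `Â(ν) = ∫₀^∞ e^{−νt} C_T(t) dt` CONVERGE in `ℝ` as `ν ↓ 0`. Reason: (R) with tolerance `ε` at two frequencies `ν, ν' < ν₀(ε)` and the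
  landed fixed-frequency matching `F_N(ν)/N → Â(ν)` give `|Â(ν) − Â(ν')| ≤ 2ε` — the Abel means are CAUCHY at `0⁺`
  (`abel_cauchy_of_regularity`, `exists_tendsto_of_cauchy_nhdsGT`).
* `stub_abelFloorOfBridge` : (R) → CLB → `∃ a, ν₀ > 0, ∀ ν ∈ (0, ν₀), a ≤ Â(ν)` (a BULK ABEL FLOOR). Reason: the landed open-chain
  Green–Kubo identity (`Corrector.openChainGreenKubo_holds`, KDN) identifies the response coefficients `D_N = ∫₀^∞c_N/((N−1)T²)`
  (`N ≥ 2`), so CLB gives `∫₀^∞ c_N ≥ c(N−1)T²`; (R) at `ε = cT²/4` gives `F_N(ν) ≥ ∫₀^∞c_N − εN`; matching gives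
  `Â(ν) ≥ cT²/2 − ε = cT²/4`.

Plumbing exactly as in the landed `LinearCeiling.SpikeLemma.stub_abelMeanCeiling` (canonical Buttà–Marchioro twin
`RegularityCollapse.stub_canonicalTwin` transported to bath constant `1`, `LoomisCompactHorizonWitness.stub_regularDLRUnique` /
`stub_fixedFrequencyMatching`, `nessUnique_proof`, `exists_steadyFamily_response`, `integral_totalBondCurrent_gibbsMeasure`).
No definitions, no named facts. Lead prover-line-stmt-AtomisticToContinuum-15382-0, 2026-08-17 (cycle 1).
-/

noncomputable section

namespace Summit.AtomisticToContinuum.FouriersLaw.Theorems.LinearSpread.KaramataCollapse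

open MeasureTheory Filter Set
open scoped Topology BigOperators
open Literature.MathematicalPhysics.KineticTheory.HeatConduction

/-! ## §1 Pure real analysis: Cauchy Abel means from regularity with tolerance -/

/-- **Abel means are Cauchy under (R) with tolerance.** Let `c_N` be eventually integrable on `(0,∞)`, let
`|∫₀^∞(1−e^{−νt})c_N| ≤ εN` eventually in `N` for every `ν ∈ (0, ν₀(ε))` and every `ε > 0`, and let the normalised Abel means
converge at every fixed frequency, `(∫₀^∞e^{−νt}c_N)/N → A(ν)`. Then `|A(ν) − A(ν')| ≤ 2ε` for `ν, ν' ∈ (0, ν₀(ε))`. [folklore] -/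
theorem abel_cauchy_of_regularity (c : ℕ → ℝ → ℝ) (A : ℝ → ℝ)
    (hint : ∀ᶠ N : ℕ in atTop, IntegrableOn (c N) (Ioi 0))
    (hR : ∀ ε : ℝ, 0 < ε → ∃ ν₀ : ℝ, 0 < ν₀ ∧ ∀ ν : ℝ, 0 < ν → ν < ν₀ → ∀ᶠ N : ℕ in atTop,
      |∫ t in Ioi (0:ℝ), (1 - Real.exp (-(ν * t))) * c N t| ≤ ε * N)
    (hlim : ∀ ν : ℝ, 0 < ν → Tendsto (fun N : ℕ => (∫ t in Ioi (0:ℝ), Real.exp (-(ν * t)) * c N t) / (N : ℝ))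
      atTop (𝓝 (A ν))) :
    ∀ ε : ℝ, 0 < ε → ∃ ν₀ : ℝ, 0 < ν₀ ∧ ∀ ν ν' : ℝ, 0 < ν → ν < ν₀ → 0 < ν' → ν' < ν₀ → |A ν - A ν'| ≤ 2 * ε := by
  intro ε hε
  obtain ⟨ν₀, hν₀, hRν⟩ := hR ε hε
  refine ⟨ν₀, hν₀, fun ν ν' hν hνlt hν' hν'lt => ?_⟩
  have hev : ∀ᶠ N : ℕ in atTop,
      |(∫ t in Ioi (0:ℝ), Real.exp (-(ν * t)) * c N t) / (N : ℝ) -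
        (∫ t in Ioi (0:ℝ), Real.exp (-(ν' * t)) * c N t) / (N : ℝ)| ≤ 2 * ε := by
    filter_upwards [hint, hRν ν hν hνlt, hRν ν' hν' hν'lt, eventually_ge_atTop 1] with N hcN h1 h2 h1N
    have hNpos : (0:ℝ) < N := by exact_mod_cast h1N
    rw [Summit.AtomisticToContinuum.FouriersLaw.Theorems.AbelSpreadCeiling.RegularityCollapse.integral_one_sub_exp_mul
      (c N) hν hcN] at h1
    rw [Summit.AtomisticToContinuum.FouriersLaw.Theorems.AbelSpreadCeiling.RegularityCollapse.integral_one_sub_exp_mul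
      (c N) hν' hcN] at h2
    set F := ∫ t in Ioi (0:ℝ), Real.exp (-(ν * t)) * c N t
    set F' := ∫ t in Ioi (0:ℝ), Real.exp (-(ν' * t)) * c N t
    set I := ∫ t in Ioi (0:ℝ), c N t
    have h3 : |F - F'| ≤ 2 * ε * N := by
      have e : F - F' = (I - F') - (I - F) := by ring
      rw [e]
      exact (abs_sub _ _).trans (by linarith)
    rw [← sub_div, abs_div, abs_of_pos hNpos, div_le_iff₀ hNpos]
    exact h3
  have hT : Tendsto (fun N : ℕ => |(∫ t in Ioi (0:ℝ), Real.exp (-(ν * t)) * c N t) / (N : ℝ) -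
      (∫ t in Ioi (0:ℝ), Real.exp (-(ν' * t)) * c N t) / (N : ℝ)|) atTop (𝓝 |A ν - A ν'|) :=
    ((hlim ν hν).sub (hlim ν' hν')).abs
  exact le_of_tendsto hT hev

/-- **A function Cauchy at `0⁺` has a right limit there** (completeness of `ℝ`): if for every `ε > 0` there is `ν₀ > 0` with
`|A ν − A ν'| ≤ ε` for all `ν, ν' ∈ (0, ν₀)`, then `A` converges along `𝓝[>] 0`. [folklore] -/
theorem exists_tendsto_of_cauchy_nhdsGT (A : ℝ → ℝ)
    (h : ∀ ε : ℝ, 0 < ε → ∃ ν₀ : ℝ, 0 < ν₀ ∧ ∀ ν ν' : ℝ, 0 < ν → ν < ν₀ → 0 < ν' → ν' < ν₀ → |A ν - A ν'| ≤ ε) :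
    ∃ L : ℝ, Tendsto A (𝓝[>] (0:ℝ)) (𝓝 L) := by
  rw [← cauchy_map_iff_exists_tendsto]
  refine Metric.cauchy_iff.2 ⟨Filter.map_neBot, fun ε hε => ?_⟩
  obtain ⟨ν₀, hν₀, hν⟩ := h (ε / 2) (half_pos hε)
  refine ⟨A '' Ioo 0 ν₀, ?_, ?_⟩
  · exact Filter.mem_map.2 (mem_of_superset (Ioo_mem_nhdsGT hν₀) (subset_preimage_image A _))
  · rintro x ⟨ν, hνm, rfl⟩ y ⟨ν', hν'm, rfl⟩
    rw [Real.dist_eq]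
    exact (hν ν ν' hνm.1 hνm.2 hν'm.1 hν'm.2).trans_lt (half_lt_self hε)

/-! ## §2 The two stubs -/

/-- **Stub `stub_abelRegularityOfRegularity` (registered signature, verbatim) — (R) ⇒ `AbelRegularity`.** For the pinned
anharmonic chain, N-uniform Abelian regularity of the open chain's equilibrium current autocorrelation
(`CoercivePulse.UniformAbelianRegularity`, item stmt-AtomisticToContinuum-13416) implies that for every guarded pair `(μ, D)` the
Abel means `∫₀^∞e^{−νt}C_T` converge in `ℝ` as `ν ↓ 0` — in particular `CoercivePulse.AbelRegularity` (item
stmt-AtomisticToContinuum-15384), whose `+∞` branch and oscillation are both excluded: (R) with tolerance `ε` at two frequencies plus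
fixed-frequency open/closed matching make the Abel means Cauchy at `0⁺`. [folklore] -/
theorem stub_abelRegularityOfRegularity :
    Summit.AtomisticToContinuum.FouriersLaw.Theses.CoercivePulse.UniformAbelianRegularity →
      Summit.AtomisticToContinuum.FouriersLaw.Theses.CoercivePulse.AbelRegularity := by
  intro hRstub ω₂ lam β γ hω hl hβ T hT μ hG hSI hR D hP _hShift _hAC _hIntC
  left
  -- the canonical BM twin, transported to bath constant 1 (same carrier, flow and fields), and the landed matching
  obtain ⟨D', hcar, -, -, hP', -, hAC', hCC⟩ :=
    Summit.AtomisticToContinuum.FouriersLaw.Theorems.AbelSpreadCeiling.RegularityCollapse.stub_canonicalTwin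
      ω₂ lam β γ hω hl hβ T hT μ hG hSI hR D hP
  let D₁ : InfiniteChainDynamics (pinnedChain ω₂ lam β 1) :=
    ⟨D'.carrier, D'.flow, D'.mapsTo, D'.flow_zero, D'.isSolution, D'.unique⟩
  have hG₁ : (pinnedChain ω₂ lam β 1).IsChainGibbsMeasure T μ := hG
  have hSS₁ : (pinnedChain ω₂ lam β 1).HasSuperstabilityEstimate μ :=
    OscillatorChain.hasSuperstabilityEstimate_of_isShiftInvariant_pinnedChain 1 hω hl.le hβ.le hT hG₁ hSI
  have hcar₁ : D₁.carrier ⊆ (pinnedChain ω₂ lam β 1).bmGood := subset_of_eq hcar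
  have hPres₁ : D₁.PreservesMeasure μ := hP'
  have hAC₁ : ∀ t : ℝ, D₁.HasAbsConvergentCorrelation μ t := hAC'
  have hUniq :=
    Summit.AtomisticToContinuum.FouriersLaw.Theorems.AbelThermodynamicLimit.LoomisCompactHorizonWitness.stub_regularDLRUnique
      ω₂ lam β 1 hω hl hβ one_pos T hT
  have hMatch :=
    Summit.AtomisticToContinuum.FouriersLaw.Theorems.AbelThermodynamicLimit.LoomisCompactHorizonWitness.stub_fixedFrequencyMatching
      ω₂ lam β 1 hω hl hβ one_pos T hT hUniq μ D₁ hG₁ hSI hSS₁ hcar₁ hPres₁ hAC₁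
  have hcc : ∀ t : ℝ, D₁.currentCorrelation μ t = D.currentCorrelation μ t := fun t => by
    rw [← hCC t]; rfl
  -- the open chain at bath constant 1: uniqueness, a steady family, integrability of c_N (landed KDN identity)
  have hUq := Summit.AtomisticToContinuum.FouriersLaw.Theorems.nessUnique_proof ω₂ lam β 1 hω hl hβ one_pos
  obtain ⟨μc, -, hμc, -⟩ :=
    Summit.AtomisticToContinuum.FouriersLaw.Theorems.AbelThermodynamicLimit.LoomisCompactHorizonWitness.exists_steadyFamily_response
      ω₂ lam β 1 hω hl hβ one_pos hUq T hT
  let c : ℕ → ℝ → ℝ := fun N t => ∫ z, (∑ i : Fin N, (pinnedChain ω₂ lam β 1).bondCurrent N i z) *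
      (∫ y, (∑ i : Fin N, (pinnedChain ω₂ lam β 1).bondCurrent N i y)
        ∂((pinnedChain ω₂ lam β 1).transitionKernel N T T t.toNNReal z)) ∂((pinnedChain ω₂ lam β 1).gibbsMeasure N T)
  have hint : ∀ᶠ N : ℕ in atTop, IntegrableOn (c N) (Ioi 0) := by
    rw [eventually_atTop]
    refine ⟨2, fun N hN2 => ?_⟩
    have hGK := Summit.AtomisticToContinuum.FouriersLaw.Theorems.OddSectorIrreversibility.Corrector.openChainGreenKubo_holds
      ω₂ lam β 1 hω hl hβ one_pos hUq μc hμc T hT N hN2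
    have hm0 :=
      Summit.AtomisticToContinuum.FouriersLaw.Theorems.OddSectorIrreversibility.Corrector.integral_totalBondCurrent_gibbsMeasure
        ω₂ lam β 1 N T
    dsimp only at hGK
    rw [hm0, mul_zero] at hGK
    simp only [sub_zero] at hGK
    exact hGK.1
  -- (R) at bath constant 1 with tolerance ε
  have hRev : ∀ ε : ℝ, 0 < ε → ∃ ν₀ : ℝ, 0 < ν₀ ∧ ∀ ν : ℝ, 0 < ν → ν < ν₀ → ∀ᶠ N : ℕ in atTop,
      |∫ t in Ioi (0:ℝ), (1 - Real.exp (-(ν * t))) * c N t| ≤ ε * N := by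
    intro ε hε
    obtain ⟨ν₀, hν₀, hRν⟩ := hRstub ω₂ lam β 1 hω hl hβ one_pos T hT ε hε
    refine ⟨ν₀, hν₀, fun ν hν hν' => ?_⟩
    obtain ⟨N₀, hN₀⟩ := hRν ν hν hν'
    rw [eventually_atTop]
    exact ⟨N₀, fun N hN => hN₀ N hN⟩
  -- the Abel means of the pair are Cauchy at 0⁺, hence converge
  set A : ℝ → ℝ := fun ν => ∫ t in Ioi (0:ℝ), Real.exp (-(ν * t)) * D.currentCorrelation μ t with hA
  have hlim : ∀ ν : ℝ, 0 < ν → Tendsto (fun N : ℕ => (∫ t in Ioi (0:ℝ), Real.exp (-(ν * t)) * c N t) / (N : ℝ))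
      atTop (𝓝 (A ν)) := by
    intro ν hν
    have h := hMatch ν hν
    simp only [hcc] at h
    exact h
  have hC := abel_cauchy_of_regularity c A hint hRev hlim
  refine exists_tendsto_of_cauchy_nhdsGT A fun ε hε => ?_
  obtain ⟨ν₀, hν₀, h⟩ := hC (ε / 2) (half_pos hε)
  exact ⟨ν₀, hν₀, fun ν ν' h1 h2 h3 h4 => (h ν ν' h1 h2 h3 h4).trans (by linarith)⟩

/-- **Stub `stub_abelFloorOfBridge` (registered signature, verbatim) — (R) ∧ CLB ⇒ a bulk Abel floor for every guarded pair.**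
For the pinned anharmonic chain, (R) = `CoercivePulse.UniformAbelianRegularity` (stmt-13416) and the Ohmic lower bound on the open
chain's response coefficients CLB = `CoercivePulse.ConductanceLowerBound` (stmt-11749) imply that for every guarded pair `(μ, D)`
there are `a, ν₀ > 0` with `a ≤ ∫₀^∞e^{−νt}C_T(t)dt` for all `ν ∈ (0, ν₀)`: the open-chain Green–Kubo identity
`D_N = ∫₀^∞c_N/((N−1)T²)` (Kundu–Dhar–Narayan, landed `Corrector.openChainGreenKubo_holds`) turns CLB into `∫₀^∞c_N ≥ c(N−1)T²`,
(R) at `ε = cT²/4` keeps `F_N(ν) ≥ ∫₀^∞c_N − εN`, and fixed-frequency matching `F_N(ν)/N → Â(ν)` passes the floor `cT²/4` to the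
infinite chain. [cite: KunduDharNarayan2009, p. 3] -/
theorem stub_abelFloorOfBridge :
    Summit.AtomisticToContinuum.FouriersLaw.Theses.CoercivePulse.UniformAbelianRegularity →
      Summit.AtomisticToContinuum.FouriersLaw.Theses.CoercivePulse.ConductanceLowerBound →
      ∀ ω₂ lam β γ : ℝ, 0 < ω₂ → 0 < lam → 0 < β → ∀ T : ℝ, 0 < T → ∀ μ : MeasureTheory.Measure Literature.MathematicalPhysics.KineticTheory.HeatConduction.ChainConfig, (Literature.MathematicalPhysics.KineticTheory.HeatConduction.pinnedChain ω₂ lam β γ).IsChainGibbsMeasure T μ → Literature.MathematicalPhysics.KineticTheory.HeatConduction.IsShiftInvariant μ → μ.map (fun σ : Literature.MathematicalPhysics.KineticTheory.HeatConduction.ChainConfig => fun x : ℤ => ((σ x).1, -(σ x).2)) = μ → ∀ D : Literature.MathematicalPhysics.KineticTheory.HeatConduction.InfiniteChainDynamics (Literature.MathematicalPhysics.KineticTheory.HeatConduction.pinnedChain ω₂ lam β γ), D.PreservesMeasure μ → ∃ a ν₀ : ℝ, 0 < a ∧ 0 < ν₀ ∧ ∀ ν : ℝ, 0 < ν → ν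 < ν₀ → a ≤ ∫ t in Set.Ioi (0:ℝ), Real.exp (-(ν * t)) * D.currentCorrelation μ t := by
  intro hRstub hCLB ω₂ lam β γ hω hl hβ T hT μ hG hSI hR D hP
  -- the canonical BM twin, transported to bath constant 1, and the landed matching
  obtain ⟨D', hcar, -, -, hP', -, hAC', hCC⟩ :=
    Summit.AtomisticToContinuum.FouriersLaw.Theorems.AbelSpreadCeiling.RegularityCollapse.stub_canonicalTwin
      ω₂ lam β γ hω hl hβ T hT μ hG hSI hR D hP
  let D₁ : InfiniteChainDynamics (pinnedChain ω₂ lam β 1) :=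
    ⟨D'.carrier, D'.flow, D'.mapsTo, D'.flow_zero, D'.isSolution, D'.unique⟩
  have hG₁ : (pinnedChain ω₂ lam β 1).IsChainGibbsMeasure T μ := hG
  have hSS₁ : (pinnedChain ω₂ lam β 1).HasSuperstabilityEstimate μ :=
    OscillatorChain.hasSuperstabilityEstimate_of_isShiftInvariant_pinnedChain 1 hω hl.le hβ.le hT hG₁ hSI
  have hcar₁ : D₁.carrier ⊆ (pinnedChain ω₂ lam β 1).bmGood := subset_of_eq hcar
  have hPres₁ : D₁.PreservesMeasure μ := hP'
  have hAC₁ : ∀ t : ℝ, D₁.HasAbsConvergentCorrelation μ t := hAC'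
  have hUniq :=
    Summit.AtomisticToContinuum.FouriersLaw.Theorems.AbelThermodynamicLimit.LoomisCompactHorizonWitness.stub_regularDLRUnique
      ω₂ lam β 1 hω hl hβ one_pos T hT
  have hMatch :=
    Summit.AtomisticToContinuum.FouriersLaw.Theorems.AbelThermodynamicLimit.LoomisCompactHorizonWitness.stub_fixedFrequencyMatching
      ω₂ lam β 1 hω hl hβ one_pos T hT hUniq μ D₁ hG₁ hSI hSS₁ hcar₁ hPres₁ hAC₁
  have hcc : ∀ t : ℝ, D₁.currentCorrelation μ t = D.currentCorrelation μ t := fun t => by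
    rw [← hCC t]; rfl
  -- the open chain at bath constant 1: uniqueness, a steady family WITH its response coefficients, KDN
  have hUq := Summit.AtomisticToContinuum.FouriersLaw.Theorems.nessUnique_proof ω₂ lam β 1 hω hl hβ one_pos
  obtain ⟨μc, Dn, hμc, hDn⟩ :=
    Summit.AtomisticToContinuum.FouriersLaw.Theorems.AbelThermodynamicLimit.LoomisCompactHorizonWitness.exists_steadyFamily_response
      ω₂ lam β 1 hω hl hβ one_pos hUq T hT
  let c : ℕ → ℝ → ℝ := fun N t => ∫ z, (∑ i : Fin N, (pinnedChain ω₂ lam β 1).bondCurrent N i z) *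
      (∫ y, (∑ i : Fin N, (pinnedChain ω₂ lam β 1).bondCurrent N i y)
        ∂((pinnedChain ω₂ lam β 1).transitionKernel N T T t.toNNReal z)) ∂((pinnedChain ω₂ lam β 1).gibbsMeasure N T)
  have hKDN : ∀ N : ℕ, 2 ≤ N → IntegrableOn (c N) (Ioi 0) ∧
      Dn N = (∫ t in Ioi (0:ℝ), c N t) / (((N : ℝ) - 1) * T ^ 2) := by
    intro N hN2
    have hGK := Summit.AtomisticToContinuum.FouriersLaw.Theorems.OddSectorIrreversibility.Corrector.openChainGreenKubo_holds
      ω₂ lam β 1 hω hl hβ one_pos hUq μc hμc T hT N hN2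
    have hm0 :=
      Summit.AtomisticToContinuum.FouriersLaw.Theorems.OddSectorIrreversibility.Corrector.integral_totalBondCurrent_gibbsMeasure
        ω₂ lam β 1 N T
    dsimp only at hGK
    rw [hm0, mul_zero] at hGK
    simp only [sub_zero] at hGK
    exact ⟨hGK.1, tendsto_nhds_unique (hDn N) hGK.2⟩
  have hint : ∀ᶠ N : ℕ in atTop, IntegrableOn (c N) (Ioi 0) := by
    rw [eventually_atTop]; exact ⟨2, fun N hN2 => (hKDN N hN2).1⟩
  -- CLB at bath constant 1: an Ohmic floor on the response coefficients, i.e. ∫₀^∞ c_N ≥ c (N-1) T²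
  obtain ⟨cf, hcf, N₁, hN₁⟩ := hCLB ω₂ lam β 1 hω hl hβ one_pos hUq μc hμc T hT Dn hDn
  have hIfloor : ∀ᶠ N : ℕ in atTop, cf * (((N : ℝ) - 1) * T ^ 2) ≤ ∫ t in Ioi (0:ℝ), c N t := by
    rw [eventually_atTop]
    refine ⟨max N₁ 2, fun N hN => ?_⟩
    have hN2 : 2 ≤ N := (le_max_right _ _).trans hN
    have h1 := hN₁ N ((le_max_left _ _).trans hN)
    rw [(hKDN N hN2).2] at h1
    have hpos : 0 < ((N : ℝ) - 1) * T ^ 2 := by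
      have : (2:ℝ) ≤ N := by exact_mod_cast hN2
      have : 0 < (N : ℝ) - 1 := by linarith
      positivity
    rwa [le_div_iff₀ hpos] at h1
  -- (R) at bath constant 1 with tolerance ε = cf T² / 4
  have hε : 0 < cf * T ^ 2 / 4 := by positivity
  obtain ⟨ν₀, hν₀, hRν⟩ := hRstub ω₂ lam β 1 hω hl hβ one_pos T hT (cf * T ^ 2 / 4) hε
  refine ⟨cf * T ^ 2 / 4, ν₀, hε, hν₀, fun ν hν hνlt => ?_⟩
  obtain ⟨N₀, hN₀⟩ := hRν ν hν hνlt
  have hRev : ∀ᶠ N : ℕ in atTop, |∫ t in Ioi (0:ℝ), (1 - Real.exp (-(ν * t))) * c N t| ≤ cf * T ^ 2 / 4 * N := by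
    rw [eventually_atTop]; exact ⟨N₀, fun N hN => hN₀ N hN⟩
  -- eventually F_N(ν)/N ≥ cf T²/4
  have hev : ∀ᶠ N : ℕ in atTop,
      cf * T ^ 2 / 4 ≤ (∫ t in Ioi (0:ℝ), Real.exp (-(ν * t)) * c N t) / (N : ℝ) := by
    filter_upwards [hint, hRev, hIfloor, eventually_ge_atTop 2] with N hcN hRN hIN h2N
    have hN2 : (2:ℝ) ≤ N := by exact_mod_cast h2N
    have hNpos : (0:ℝ) < N := by linarith
    rw [Summit.AtomisticToContinuum.FouriersLaw.Theorems.AbelSpreadCeiling.RegularityCollapse.integral_one_sub_exp_mul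
      (c N) hν hcN] at hRN
    set F := ∫ t in Ioi (0:ℝ), Real.exp (-(ν * t)) * c N t
    set I := ∫ t in Ioi (0:ℝ), c N t
    have h1 : I - F ≤ cf * T ^ 2 / 4 * N := (le_abs_self _).trans hRN
    have hT2 : 0 ≤ cf * T ^ 2 := by positivity
    rw [le_div_iff₀ hNpos]
    nlinarith
  have hlim : Tendsto (fun N : ℕ => (∫ t in Ioi (0:ℝ), Real.exp (-(ν * t)) * c N t) / (N : ℝ)) atTop
      (𝓝 (∫ t in Ioi (0:ℝ), Real.exp (-(ν * t)) * D.currentCorrelation μ t)) := by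
    have h := hMatch ν hν
    simp only [hcc] at h
    exact h
  exact ge_of_tendsto hlim hev

end Summit.AtomisticToContinuum.FouriersLaw.Theorems.LinearSpread.KaramataCollapse

end
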